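import Mathlib
import Summits.QuantumFields.BalabanUV.T4Continuum.Support.SliceFlatOperators
import Summits.QuantumFields.BalabanUV.T4Continuum.Support.SliceFlatMassTerm
import Summits.QuantumFields.BalabanUV.T4Continuum.Support.SliceFlatFreeResolvent

/-!
# T⁴ programme, node NE3 (η-rate of the minimisers) — THE FLAT RUNG, part 12: preparation of the gradient assembly —
# weighted-row toolkit on the NE3 carrier, the RESOLVENT IDENTITY `gFlat = F + F·W·gFlat` around the free operator, and the
# symmetry of `gFlat`

Fifteenth generation of the NE3 prover lineage P1 of the cell `pub-balaban`, file 6 of the free-gradient chain (end point: the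
flat `hT31` item 1 of the lineage's one type p199789, part 13 `SliceFlatGradient`).  THIS FILE holds the bookkeeping that turns
block-localised row bounds into exponentially weighted row norms and back, and the algebra of the comparison with the free
operator of part 11:
 * §1 WEIGHTED ROWS (`Σ_z |A(x,z)|·e^{δρ(x,z)/s}`, the currency of the tree's `T4SliceTelescoping` ∕ `T4SliceOperatorData`):
   submultiplicativity under the triangle inequality (`weightedRow_mul_le`); on the NE3 carrier at level `j ≤ k`, scale `L^j`:
   the cube count `#{q : cubeI j q = b} ≤ (d+1)·(L^j)^{d+1}`, the reverse distance dictionary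
   `L^j·nbd_j(cubeI x, cubeI z) ≤ ρ(x,z) + (d+1)(L^j − 1)` (from part 9's `mul_pabs_blockOf_sub_le`), hence WEIGHTED ⇒ CUBE-LOCALISED
   (`cubeSum_le_of_weightedRow`: `Σ_{z ∈ Δ(y₁)} |A(x,z)| ≤ α·e^{δ(d+1)}·e^{−δ·nbd}`), and CUBE-LOCALISED ⇒ WEIGHTED
   (`weightedRow_of_cubeRows`, the tree's `weightedRow_of_cubeData` with the torus shell count `card_nbd_eq_le`);
 * §2 THE COMPARISON: `Wfl j := n⁻²·1 − massKernel_j − flatNg j` (`= (stencilE + n⁻²·1) − kFlat j` by `SliceFlatStencil.flatE_eq_stencil`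
   and the definition of `flatNg`), the RESOLVENT IDENTITY **`gFlat j = freeOp j + freeOp j·Wfl j·gFlat j`** (part 11's
   `freeOp_mul_stencil` and `SliceFlatOperators.kFlat_mul_gFlat`), its row-differenced form
   `rowDiff ν (gFlat j) = rowDiff ν (freeOp j) + rowDiff ν (freeOp j)·Wfl j·gFlat j`, the SYMMETRY `(gFlat j)ᵀ = gFlat j` (pv15's
   `DeltaAR_posDef` through `kFlat_posDef`), and the column-difference matrix `colDiff ν` with
   `(gFlat j·colDiff ν)(z,x) = rowDiff ν (gFlat j)(x,z)` — the dictionary between the one type's `hA1 : A 1 = (G·D)ᵀ` and row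
   differences.
No estimate of Bałaban's is asserted; the constants of part 13 are assembled there.

Honest framing: finite-T⁴ ultraviolet bookkeeping about MINIMISERS (rung (B)+1 of the cell's ladder); no conditional of the
cell (`BetaPertH`, (B), (B^μ)) is used or hidden; nothing bears on infinite volume, a mass gap, or the Clay problem; NE3 is NOT
proved by this file.  ABSOLUTE RULE of the cell kept: inputs are kernel-proved tree modules only (`SliceFlatOperators` p199225,
parts 9–11, the tree's `T4SliceOperatorData`); every declaration is a [model] definition or a [folklore] theorem; no
`def … : Prop`, no `sorry`, no axioms beyond Mathlib's.  PLACEMENT (human rule 2026-08-19): cell work under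
`Summits/QuantumFields/BalabanUV/`; moves nothing.  Records: `t4/T4-EST-U1b-OSC.md` v1.32, `t4/T4-EST-NE3-P1.md` v2.31 of the
cell `pub-balaban`.
-/

noncomputable section

open Real Finset Matrix

namespace Summit.QuantumFields.BalabanUV.T4Continuum.SliceFlatGradientPrep

open Literature.MathematicalPhysics.QuantumFieldTheory.Balaban1983to89
open Literature.MathematicalPhysics.QuantumFieldTheory.Balaban1983to89.TreeLengthTorus (TPt)
open Literature.MathematicalPhysics.QuantumFieldTheory.Balaban1983to89.B12Decay510Torus (pabs pabs_nonneg pl1_eq_sum)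
open Literature.MathematicalPhysics.QuantumFieldTheory.Balaban1983to89.T4SliceOperatorData (massKernel abs_massKernel_le
  countConst countConst_pos weightedRow_of_cubeData)
open Summit.QuantumFields.BalabanUV.T4Continuum.SliceTorusBlocks
open Summit.QuantumFields.BalabanUV.T4Continuum.SliceTorusTower
open Summit.QuantumFields.BalabanUV.T4Continuum.SliceCovariantModel
open Summit.QuantumFields.BalabanUV.T4Continuum.SliceCovariantTower
open Summit.QuantumFields.BalabanUV.T4Continuum.SliceTorusComb
open Summit.QuantumFields.BalabanUV.T4Continuum.SliceFlatPropagator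
open Summit.QuantumFields.BalabanUV.T4Continuum.SliceFlatOperators
open Summit.QuantumFields.BalabanUV.T4Continuum.SliceFlatStencil
open Summit.QuantumFields.BalabanUV.T4Continuum.SliceFlatHeatTorus
open Summit.QuantumFields.BalabanUV.T4Continuum.SliceFlatFreeResolvent

/-! ## §1  Weighted rows: submultiplicativity, and the passage to and from cube-localised row sums on the NE3 carrier -/
section Weighted

/-- **Weighted row norms are submultiplicative** under a multiplicative weight (`E(x,z) ≤ E(x,w)·E(w,z)`, e.g. `E = e^{δρ/s}` with
the triangle inequality): rows of `A` bounded by `a` and rows of `B` by `b ≥ 0` give rows of `A·B` bounded by `a·b`. [folklore] -/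
theorem weightedRow_mul_le {X : Type*} [Fintype X] (A B : Matrix X X ℝ) (E : X → X → ℝ) {a b : ℝ} (hb : 0 ≤ b)
    (hE0 : ∀ x z, 0 ≤ E x z) (hE : ∀ x w z, E x z ≤ E x w * E w z)
    (hA : ∀ x, ∑ z, |A x z| * E x z ≤ a) (hB : ∀ w, ∑ z, |B w z| * E w z ≤ b) (x : X) :
    ∑ z, |(A * B) x z| * E x z ≤ a * b := by
  calc ∑ z, |(A * B) x z| * E x z ≤ ∑ z, ∑ w, |A x w| * |B w z| * (E x w * E w z) := by
        refine Finset.sum_le_sum fun z _ => ?_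
        rw [Matrix.mul_apply]
        calc |∑ w, A x w * B w z| * E x z ≤ (∑ w, |A x w * B w z|) * E x z :=
              mul_le_mul_of_nonneg_right (Finset.abs_sum_le_sum_abs _ _) (hE0 x z)
          _ = ∑ w, |A x w| * |B w z| * E x z := by rw [Finset.sum_mul]; simp_rw [abs_mul]
          _ ≤ ∑ w, |A x w| * |B w z| * (E x w * E w z) :=
              Finset.sum_le_sum fun w _ => mul_le_mul_of_nonneg_left (hE x w z) (by positivity)
    _ = ∑ w, (|A x w| * E x w) * ∑ z, |B w z| * E w z := by
        rw [Finset.sum_comm]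
        refine Finset.sum_congr rfl fun w _ => ?_
        rw [Finset.mul_sum]
        exact Finset.sum_congr rfl fun z _ => by ring
    _ ≤ ∑ w, (|A x w| * E x w) * b :=
        Finset.sum_le_sum fun w _ => mul_le_mul_of_nonneg_left (hB w) (mul_nonneg (abs_nonneg _) (hE0 x w))
    _ = (∑ w, |A x w| * E x w) * b := by rw [Finset.sum_mul]
    _ ≤ a * b := mul_le_mul_of_nonneg_right (hA x) hb

/-- The exponential weight `e^{δρ(x,z)/s}` is multiplicative under the three-point triangle inequality. [folklore] -/
theorem expWeight_triangle {X : Type*} (ρ : X → X → ℝ) {δ s : ℝ} (hδ : 0 ≤ δ) (hs : 0 < s)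
    (htri : ∀ x w z, ρ x z ≤ ρ x w + ρ w z) (x w z : X) :
    Real.exp (δ * (ρ x z / s)) ≤ Real.exp (δ * (ρ x w / s)) * Real.exp (δ * (ρ w z / s)) := by
  rw [← Real.exp_add]
  refine Real.exp_le_exp.2 ?_
  rw [← mul_add, ← add_div]
  exact mul_le_mul_of_nonneg_left (div_le_div_of_nonneg_right (htri x w z) hs.le) hδ

variable (d k N L : ℕ) [NeZero N] [NeZero L]

/-- The three-point triangle inequality for the carrier distance `rhoI`. [folklore] -/
theorem rhoI_triangle3 (x w z : TPt (d + 1) (N * L ^ k) × Fin (d + 1)) :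
    rhoI (d + 1) k N L (Fin (d + 1)) x z ≤ rhoI (d + 1) k N L (Fin (d + 1)) x w + rhoI (d + 1) k N L (Fin (d + 1)) w z := by
  have h := rhoI_triangle (d + 1) k N L (Fin (d + 1)) x w w z
  have h0 : rhoI (d + 1) k N L (Fin (d + 1)) w w = 0 := by
    unfold rhoI rho; rw [sub_self, pl1_eq_sum]; simp
  linarith

/-- A one-dimensional block holds at most `n` residues (`P = Q·n`). [folklore] -/
theorem card_blockFibre_le {P Q n : ℕ} [NeZero P] (hP : P = Q * n) (b : ZMod Q) :
    (Finset.univ.filter (fun c : ZMod P => blockOf Q n c = b)).card ≤ n := by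
  classical
  have hn : 0 < n := pos_of_mul_eq hP
  let f : ZMod P → Fin n := fun c => ⟨c.val % n, Nat.mod_lt _ hn⟩
  have hinj : Set.InjOn f (Finset.univ.filter (fun c : ZMod P => blockOf Q n c = b) : Set (ZMod P)) := by
    intro c hc c' hc' hcc'
    have hb : blockOf Q n c = blockOf Q n c' := by
      rw [(Finset.mem_filter.1 (Finset.mem_coe.1 hc)).2, (Finset.mem_filter.1 (Finset.mem_coe.1 hc')).2]
    have hq : c.val / n = c'.val / n := by
      have := congrArg ZMod.val hb
      rwa [val_blockOf hP, val_blockOf hP] at this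
    have hr : c.val % n = c'.val % n := by simpa [f] using congrArg Fin.val hcc'
    apply ZMod.val_injective
    rw [← Nat.div_add_mod c.val n, ← Nat.div_add_mod c'.val n, hq, hr]
  calc (Finset.univ.filter (fun c : ZMod P => blockOf Q n c = b)).card
      ≤ (Finset.univ : Finset (Fin n)).card := Finset.card_le_card_of_injOn f (fun c _ => Finset.mem_univ _) hinj
    _ = n := by simp

/-- **The cube count on the carrier**: a constant summed over a block fibre, `Σ_{q : cubeI j q = b} c ≤ c·(d+1)·n^{d+1}`,
`n = L^{min(j,k)}`. [folklore] -/
theorem sum_cubeI_const_le (j : ℕ) (b : TPt (d + 1) (levM k N L j)) {c : ℝ} (hc : 0 ≤ c) :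
    ∑ _q ∈ Finset.univ.filter (fun q : TPt (d + 1) (N * L ^ k) × Fin (d + 1) => cubeI (d + 1) k N L (Fin (d + 1)) j q = b), c
      ≤ c * (((d : ℝ) + 1) * (side k L j : ℝ) ^ (d + 1)) := by
  classical
  rw [Finset.sum_const, nsmul_eq_mul, mul_comm]
  refine mul_le_mul_of_nonneg_left ?_ hc
  -- count the fibre
  have hsite : (Finset.univ.filter (fun z : TPt (d + 1) (N * L ^ k) => cube (d + 1) k N L j z = b)).card
      ≤ (side k L j) ^ (d + 1) := by
    have hfib : Finset.univ.filter (fun z : TPt (d + 1) (N * L ^ k) => cube (d + 1) k N L j z = b)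
        = Fintype.piFinset fun i => Finset.univ.filter (fun cc : ZMod (N * L ^ k) => blockOf (levM k N L j) (side k L j) cc = b i) :=
      filter_blockPt_eq_piFinset b
    rw [hfib, Fintype.card_piFinset]
    calc ∏ i, (Finset.univ.filter (fun cc : ZMod (N * L ^ k) => blockOf (levM k N L j) (side k L j) cc = b i)).card
        ≤ ∏ _i : Fin (d + 1), side k L j :=
          Finset.prod_le_prod' fun i _ => card_blockFibre_le (fine_eq_levM_mul_side k N L j) (b i)
      _ = side k L j ^ (d + 1) := by simp
  have hprod : (Finset.univ.filter (fun q : TPt (d + 1) (N * L ^ k) × Fin (d + 1) =>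
      cubeI (d + 1) k N L (Fin (d + 1)) j q = b)).card
      = (Finset.univ.filter (fun z : TPt (d + 1) (N * L ^ k) => cube (d + 1) k N L j z = b)).card * (d + 1) := by
    rw [Finset.card_eq_sum_ones, Finset.card_eq_sum_ones, Finset.sum_filter, Finset.sum_filter, Fintype.sum_prod_type]
    simp only [cubeI_apply]
    rw [Finset.sum_mul]
    refine Finset.sum_congr rfl fun z _ => ?_
    split_ifs <;> simp
  calc ((Finset.univ.filter (fun q : TPt (d + 1) (N * L ^ k) × Fin (d + 1) =>
        cubeI (d + 1) k N L (Fin (d + 1)) j q = b)).card : ℝ)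
      = (Finset.univ.filter (fun z : TPt (d + 1) (N * L ^ k) => cube (d + 1) k N L j z = b)).card * ((d : ℝ) + 1) := by
        rw [hprod]; push_cast; ring
    _ ≤ (side k L j : ℝ) ^ (d + 1) * ((d : ℝ) + 1) := by
        gcongr; exact_mod_cast hsite
    _ = ((d : ℝ) + 1) * (side k L j : ℝ) ^ (d + 1) := mul_comm _ _

/-- **The reverse distance dictionary on the carrier**: `n·nbd_j(cubeI x, cubeI z) ≤ ρ(x,z) + (d+1)(n − 1)`. [folklore] -/
theorem mul_nbd_le_rhoI (j : ℕ) (x z : TPt (d + 1) (N * L ^ k) × Fin (d + 1)) :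
    (side k L j : ℝ) * nbd (d + 1) k N L j (cubeI (d + 1) k N L (Fin (d + 1)) j x) (cubeI (d + 1) k N L (Fin (d + 1)) j z)
      ≤ rhoI (d + 1) k N L (Fin (d + 1)) x z + ((d : ℝ) + 1) * ((side k L j : ℝ) - 1) := by
  have hcast : (nbd (d + 1) k N L j (cubeI (d + 1) k N L (Fin (d + 1)) j x) (cubeI (d + 1) k N L (Fin (d + 1)) j z) : ℝ)
      = ∑ i, (pabs ((cube (d + 1) k N L j x.1 - cube (d + 1) k N L j z.1) i) : ℝ) := by
    unfold nbd; rw [cast_npl1, pl1_eq_sum]; rfl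
  have hrho : rhoI (d + 1) k N L (Fin (d + 1)) x z = ∑ i, (pabs ((x.1 - z.1) i) : ℝ) := by
    unfold rhoI rho; rw [pl1_eq_sum]
  rw [hcast, hrho, Finset.mul_sum]
  have hi : ∀ i : Fin (d + 1), (side k L j : ℝ) * (pabs ((cube (d + 1) k N L j x.1 - cube (d + 1) k N L j z.1) i) : ℝ)
      ≤ (pabs ((x.1 - z.1) i) : ℝ) + ((side k L j : ℝ) - 1) := by
    intro i
    have h := mul_pabs_blockOf_sub_le (fine_eq_levM_mul_side k N L j) (x.1 i) (z.1 i)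
    have h' : ((side k L j : ℤ) : ℝ) * ((pabs (blockOf (levM k N L j) (side k L j) (x.1 i) - blockOf (levM k N L j) (side k L j) (z.1 i)) : ℤ) : ℝ)
        ≤ ((pabs (x.1 i - z.1 i) : ℤ) : ℝ) + (((side k L j : ℤ) : ℝ) - 1) := by exact_mod_cast h
    simpa [cube, blockPt] using h'
  calc ∑ i, (side k L j : ℝ) * (pabs ((cube (d + 1) k N L j x.1 - cube (d + 1) k N L j z.1) i) : ℝ)
      ≤ ∑ i : Fin (d + 1), ((pabs ((x.1 - z.1) i) : ℝ) + ((side k L j : ℝ) - 1)) := Finset.sum_le_sum fun i _ => hi i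
    _ = _ := by rw [Finset.sum_add_distrib, Finset.sum_const, Finset.card_univ, Fintype.card_fin]; ring

/-- **WEIGHTED ⇒ CUBE-LOCALISED**: a weighted row bound `Σ_z |A(x,z)|e^{δρ(x,z)/n} ≤ α` (`n` the block side, `δ ≥ 0`) gives
`Σ_{z : cubeI j z = y₁} |A(x,z)| ≤ α·e^{δ(d+1)}·e^{−δ·nbd_j(cubeI x, y₁)}`. [folklore] -/
theorem cubeSum_le_of_weightedRow (j : ℕ) (A : Matrix (TPt (d + 1) (N * L ^ k) × Fin (d + 1)) (TPt (d + 1) (N * L ^ k) × Fin (d + 1)) ℝ)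
    {δ α : ℝ} (hδ : 0 ≤ δ) (x : TPt (d + 1) (N * L ^ k) × Fin (d + 1))
    (hA : ∑ z, |A x z| * Real.exp (δ * (rhoI (d + 1) k N L (Fin (d + 1)) x z / (side k L j : ℝ))) ≤ α)
    (y₁ : TPt (d + 1) (levM k N L j)) :
    ∑ z ∈ Finset.univ.filter (fun z => cubeI (d + 1) k N L (Fin (d + 1)) j z = y₁), |A x z|
      ≤ α * Real.exp (δ * (d + 1)) * Real.exp (-(δ * nbd (d + 1) k N L j (cubeI (d + 1) k N L (Fin (d + 1)) j x) y₁)) := by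
  have hn1 : (1 : ℝ) ≤ (side k L j : ℝ) := by exact_mod_cast one_le_side k L j
  have hn0 : (0 : ℝ) < (side k L j : ℝ) := by linarith
  set Dn : ℝ := (nbd (d + 1) k N L j (cubeI (d + 1) k N L (Fin (d + 1)) j x) y₁ : ℝ) with hDn
  have hα : 0 ≤ α := le_trans (Finset.sum_nonneg fun z _ => by positivity) hA
  -- on the fibre the weight is at least `e^{δ·nbd − δ(d+1)}`
  have hw : ∀ z ∈ Finset.univ.filter (fun z => cubeI (d + 1) k N L (Fin (d + 1)) j z = y₁),
      |A x z| ≤ Real.exp (δ * (d + 1)) * Real.exp (-(δ * Dn)) *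
        (|A x z| * Real.exp (δ * (rhoI (d + 1) k N L (Fin (d + 1)) x z / (side k L j : ℝ)))) := by
    intro z hz
    have hzb : cubeI (d + 1) k N L (Fin (d + 1)) j z = y₁ := (Finset.mem_filter.1 hz).2
    have hrev := mul_nbd_le_rhoI d k N L j x z
    rw [hzb] at hrev
    have h1 : 1 ≤ Real.exp (δ * (d + 1)) * Real.exp (-(δ * Dn)) *
        Real.exp (δ * (rhoI (d + 1) k N L (Fin (d + 1)) x z / (side k L j : ℝ))) := by
      rw [← Real.exp_add, ← Real.exp_add]
      refine Real.one_le_exp ?_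
      have h2 : δ * Dn ≤ δ * (rhoI (d + 1) k N L (Fin (d + 1)) x z / (side k L j : ℝ)) + δ * (d + 1) := by
        rw [← mul_add]
        refine mul_le_mul_of_nonneg_left ?_ hδ
        rw [div_add' _ _ _ hn0.ne', le_div_iff₀ hn0]
        have : 0 ≤ ((d : ℝ) + 1) := by positivity
        nlinarith
      linarith
    calc |A x z| = 1 * |A x z| := (one_mul _).symm
      _ ≤ _ := mul_le_mul_of_nonneg_right h1 (abs_nonneg _)
      _ = _ := by ring
  calc ∑ z ∈ Finset.univ.filter (fun z => cubeI (d + 1) k N L (Fin (d + 1)) j z = y₁), |A x z|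
      ≤ ∑ z ∈ Finset.univ.filter (fun z => cubeI (d + 1) k N L (Fin (d + 1)) j z = y₁),
          Real.exp (δ * (d + 1)) * Real.exp (-(δ * Dn)) *
            (|A x z| * Real.exp (δ * (rhoI (d + 1) k N L (Fin (d + 1)) x z / (side k L j : ℝ)))) := Finset.sum_le_sum hw
    _ = Real.exp (δ * (d + 1)) * Real.exp (-(δ * Dn)) * ∑ z ∈ Finset.univ.filter
          (fun z => cubeI (d + 1) k N L (Fin (d + 1)) j z = y₁),
          |A x z| * Real.exp (δ * (rhoI (d + 1) k N L (Fin (d + 1)) x z / (side k L j : ℝ))) := by rw [Finset.mul_sum]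
    _ ≤ Real.exp (δ * (d + 1)) * Real.exp (-(δ * Dn)) * ∑ z,
          |A x z| * Real.exp (δ * (rhoI (d + 1) k N L (Fin (d + 1)) x z / (side k L j : ℝ))) :=
        mul_le_mul_of_nonneg_left (Finset.sum_le_univ_sum_of_nonneg fun z => by positivity) (by positivity)
    _ ≤ Real.exp (δ * (d + 1)) * Real.exp (-(δ * Dn)) * α := mul_le_mul_of_nonneg_left hA (by positivity)
    _ = _ := by ring

/-- **CUBE-LOCALISED ⇒ WEIGHTED** at level `j ≤ k` (scale `L^j`): uniform cube-localised row bounds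
`Σ_{z : cubeI j z = b} |A(x,z)| ≤ α₀·e^{−δ₀·nbd_j(cubeI x, b)}` give, for `0 ≤ δ < δ₀`,
`Σ_z |A(x,z)|·e^{δρ(x,z)/L^j} ≤ α₀·e^{δ(d+1)}·2^{d+1}·countConst(δ₀ − δ, d+1)` (the tree's `weightedRow_of_cubeData` with the torus
shell count `card_nbd_eq_le` and `rhoI_le_nbd`). [folklore] -/
theorem weightedRow_of_cubeRows {j : ℕ} (hj : j ≤ k)
    (A : Matrix (TPt (d + 1) (N * L ^ k) × Fin (d + 1)) (TPt (d + 1) (N * L ^ k) × Fin (d + 1)) ℝ) {δ₀ δ α₀ : ℝ}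
    (hδ : 0 ≤ δ) (hδ₀ : δ < δ₀) (hα₀ : 0 ≤ α₀) (x : TPt (d + 1) (N * L ^ k) × Fin (d + 1))
    (hloc : ∀ b, ∑ z ∈ Finset.univ.filter (fun z => cubeI (d + 1) k N L (Fin (d + 1)) j z = b), |A x z|
      ≤ α₀ * Real.exp (-(δ₀ * nbd (d + 1) k N L j (cubeI (d + 1) k N L (Fin (d + 1)) j x) b))) :
    ∑ z, |A x z| * Real.exp (δ * (rhoI (d + 1) k N L (Fin (d + 1)) x z / (side k L j : ℝ)))
      ≤ α₀ * Real.exp (δ * (d + 1)) * ((2 : ℝ) ^ (d + 1) * countConst (δ₀ - δ) (d + 1)) := by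
  have hside : (side k L j : ℝ) = (L : ℝ) ^ j := by rw [SliceFlatMassTerm.side_eq_pow k L hj]; push_cast; rfl
  have hL : (0 : ℝ) < (L : ℝ) := by exact_mod_cast Nat.pos_of_ne_zero (NeZero.ne L)
  have hs : (0 : ℝ) < (L : ℝ) ^ j := pow_pos hL j
  rw [hside]
  have h := weightedRow_of_cubeData (cubeI (d + 1) k N L (Fin (d + 1)) j) (fun z => |A x z|)
    (fun z => rhoI (d + 1) k N L (Fin (d + 1)) x z)
    (fun b => nbd (d + 1) k N L j (cubeI (d + 1) k N L (Fin (d + 1)) j x) b) (c := (d : ℝ) + 1) (p := d + 1)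
    (A' := (2 : ℝ) ^ (d + 1)) hs hδ hδ₀ (fun z => abs_nonneg _) hα₀ (by positivity) hloc
    (fun z => by have := rhoI_le_nbd (d + 1) k N L (Fin (d + 1)) j x z; push_cast at this; linarith)
    (fun r => card_nbd_eq_le (d + 1) k N L j _ r)
  convert h using 2

end Weighted

/-! ## §2  The comparison with the free operator: `Wfl`, the resolvent identity, symmetry, column differences -/
section Comparison

variable (d k N L : ℕ) [NeZero N] [NeZero L]

/-- **The comparison form** `Wfl j := n⁻²·1 − massKernel_j − flatNg j` — the difference between the free massive stencil
`stencilE + n⁻²·1` and the flat level operator `kFlat j`. [model] -/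
def Wfl (j : ℕ) : Matrix (TPt (d + 1) (N * L ^ k) × Fin (d + 1)) (TPt (d + 1) (N * L ^ k) × Fin (d + 1)) ℝ :=
  (((side k L j : ℝ) ^ 2)⁻¹) • (1 : Matrix _ _ ℝ)
    - massKernel (cubeI (d + 1) k N L (Fin (d + 1)) j) (tau (cubeComb (d + 1) k N L j) (flatRm d k N L))
        (flatAm j / ((L : ℝ) ^ j) ^ (d + 1 + 2))
    - flatNg d k N L j

/-- `Wfl j = (stencilE + n⁻²·1) − kFlat j`. [folklore] -/
theorem Wfl_eq (j : ℕ) :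
    Wfl d k N L j = (stencilE d k N L + (((side k L j : ℝ) ^ 2)⁻¹) • (1 : Matrix _ _ ℝ)) - kFlat d k N L j := by
  have hk : kFlat d k N L j = flatNg d k N L j + flatE d k N L
      + massKernel (cubeI (d + 1) k N L (Fin (d + 1)) j) (tau (cubeComb (d + 1) k N L j) (flatRm d k N L))
          (flatAm j / ((L : ℝ) ^ j) ^ (d + 1 + 2)) := by
    unfold flatNg; abel
  rw [hk, flatE_eq_stencil, Wfl]; abel

/-- **THE RESOLVENT IDENTITY** around the free operator: `gFlat j = freeOp j + freeOp j·Wfl j·gFlat j`. [folklore] -/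
theorem gFlat_eq_free_add (j : ℕ) :
    gFlat d k N L j = freeOp d k N L j + freeOp d k N L j * Wfl d k N L j * gFlat d k N L j := by
  rw [Wfl_eq, Matrix.mul_sub, Matrix.sub_mul, freeOp_mul_stencil, Matrix.one_mul, Matrix.mul_assoc, kFlat_mul_gFlat,
    Matrix.mul_one]
  abel

/-- The row-differenced resolvent identity: `rowDiff ν gFlat = rowDiff ν F + (rowDiff ν F)·Wfl·gFlat`. [folklore] -/
theorem rowDiff_gFlat_eq (j : ℕ) (ν : Fin (d + 1)) :
    rowDiff d k N L ν (gFlat d k N L j)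
      = rowDiff d k N L ν (freeOp d k N L j) + rowDiff d k N L ν (freeOp d k N L j) * Wfl d k N L j * gFlat d k N L j := by
  conv_lhs => rw [gFlat_eq_free_add d k N L j]
  rw [rowDiff_add, rowDiff_mul, rowDiff_mul]

/-- **`gFlat j` is symmetric** (the inverse of the real positive definite, hence symmetric, `kFlat j`). [folklore] -/
theorem gFlat_transpose (j : ℕ) : (gFlat d k N L j).transpose = gFlat d k N L j := by
  have hk : (kFlat d k N L j).transpose = kFlat d k N L j := by
    have h := (kFlat_posDef d k N L j).isHermitian
    rwa [Matrix.IsHermitian, Matrix.conjTranspose_eq_transpose_of_trivial] at h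
  rw [← kFlat_inv, Matrix.transpose_nonsing_inv, hk]

/-- **The column-difference matrix** in direction `ν`: `(A·colDiff ν)(z,x) = A(z,(x₁+e_ν,x₂)) − A(z,x)` — a unit forward
difference of every ROW of `A` as a function of the column site (the one type's `D`, `hA1 : A 1 = (G·D)ᵀ`). [model] -/
def colDiff (ν : Fin (d + 1)) : Matrix (TPt (d + 1) (N * L ^ k) × Fin (d + 1)) (TPt (d + 1) (N * L ^ k) × Fin (d + 1)) ℝ :=
  fun w x => (if w = (x.1 + Pi.single ν 1, x.2) then 1 else 0) - (if w = x then 1 else 0)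

/-- `(A·colDiff ν)(z,x) = A(z,(x₁+e_ν,x₂)) − A(z,x)`. [folklore] -/
theorem mul_colDiff_apply (ν : Fin (d + 1)) (A : Matrix (TPt (d + 1) (N * L ^ k) × Fin (d + 1))
    (TPt (d + 1) (N * L ^ k) × Fin (d + 1)) ℝ) (z x : TPt (d + 1) (N * L ^ k) × Fin (d + 1)) :
    (A * colDiff d k N L ν) z x = A z (x.1 + Pi.single ν 1, x.2) - A z x := by
  classical
  simp only [Matrix.mul_apply, colDiff, mul_sub, mul_ite, mul_one, mul_zero, Finset.sum_sub_distrib, Finset.sum_ite_eq',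
    Finset.mem_univ, if_true]

/-- **Column differences of the symmetric `gFlat` are row differences**: `(gFlat j·colDiff ν)(z,x) = rowDiff ν (gFlat j)(x,z)`. [folklore] -/
theorem gFlat_mul_colDiff_apply (j : ℕ) (ν : Fin (d + 1)) (z x : TPt (d + 1) (N * L ^ k) × Fin (d + 1)) :
    (gFlat d k N L j * colDiff d k N L ν) z x = rowDiff d k N L ν (gFlat d k N L j) x z := by
  rw [mul_colDiff_apply, rowDiff]
  have hs := gFlat_transpose d k N L j
  have h1 : gFlat d k N L j z (x.1 + Pi.single ν 1, x.2) = gFlat d k N L j (x.1 + Pi.single ν 1, x.2) z := by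
    rw [← hs, Matrix.transpose_apply, hs]
  have h2 : gFlat d k N L j z x = gFlat d k N L j x z := by
    rw [← hs, Matrix.transpose_apply, hs]
  rw [h1, h2]

end Comparison

end Summit.QuantumFields.BalabanUV.T4Continuum.SliceFlatGradientPrep
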